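import Summits.QuantumFields.YangMills.Theorems.BalabanUVNodesN15KingModelTwoPointOptimalDecay

/-!
# BalabanUVNodes ∕ N15 — THE KING-MODEL RUNG (PART Ϸ-e): THE CORRELATION LENGTH OF THE FREE BLOCK FIELD IS AT MOST `1∕m` IN EVERY LATTICE DIRECTION —
# `limsup_{t→∞} |S₂^{ℝ}(z₀ + t e_ν)|^{1∕t} ≤ e^{−m}` (the exponential decay RATE of the infinite-volume two-point function along every lattice ray is at least the mass)
# (Track A, DAG node N15 = NE2; FAN-OUT v1.1 §N15 s3 «KING-MODEL RUNG»; uses part Ϸ-c's optimal bound; count-neutral)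

HONEST FRAMING.  Count-neutral (cell `pub-ymgap`, seat `pub-ymgap-dag-n15-e` g34; `--supports stmt-QuantumFields-27366 --as helper` = K3⁸
`SpineGivenEndpointR13SepCoPHV`).  King's `A = 0`, `g = 0` model ([King1986] C. King, Commun. Math. Phys. **102** (1986) 649–677): part Ϸ-c bounds the
infinite-volume block two-point function by `K_d(c,m)e^{−c|z_ν|}` for EVERY `0 < c < m`.  The `c`-uniform content of that family of bounds is the statement of
this file: along every lattice ray `t ↦ z₀ + t·e_ν` the upper exponential rate `limsup_t |S₂^{ℝ}(z₀ + t e_ν)|^{1∕t}` is at most `e^{−m}` (`m = √m²`) — in the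
language of statistical mechanics, the correlation length `ξ_ν = −1∕(limsup_t t⁻¹ log|S₂|)` of the free block field in the direction `ν` satisfies `ξ_ν ≤ 1∕m`;
«the mass gap of the model is at least its mass».  (The `t`-th root form avoids `log 0`.)  Proof: `|S₂|^{1∕t} ≤ K^{1∕t}e^{−c}` for `t ≥ 1`, `K^{1∕t} → 1`, so the
`limsup` is `≤ e^{−c}` for every `c < m`, hence `≤ e^{−m}` by continuity.  NOT a node discharge (N15 is booked through n15-a's knit, untouched here); nothing Bałaban ∕
continuum-Yang–Mills ∕ `ℝ⁴` ∕ OS ∕ Clay — the «mass gap» here is the FREE block field's, i.e. its mass `m`, NOT the Yang–Mills mass gap.  0 `sorry`, 0 def; standard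
axioms.

WHAT THIS FILE PROVES (kernel).  `ray_apply` (plumbing: `(z₀ + t e_ν)_ν = z₀,ν + t`), `abs_kingS2Inf_ray_le` (part Ϸ-c on the ray: `≤ K e^{−ct}`), ★ `rpow_inv_abs_kingS2Inf_ray_le`
(`|S₂(z₀+te_ν)|^{1∕t} ≤ K^{1∕t}e^{−c}`, `t ≥ 1`), `tendsto_const_rpow_inv` (private; `K^{1∕t} → 1`), ★★ `limsup_rpow_abs_kingS2Inf_ray_le_exp` (`≤ e^{−c}`, every `0 < c < m`),
★★★ **`limsup_rpow_abs_kingS2Inf_ray_le`** (`≤ e^{−√m²}`: THE CORRELATION LENGTH IS AT MOST `1∕m`).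

HONEST SCOPE.  King's free model; an UPPER bound on the decay rate's exponential (i.e. a LOWER bound `≥ m` on the rate); the matching lower bound on `|S₂|` (rate exactly `m`)
is not proved here.  N15 untouched; counts unmoved.  Locators (use): [King1986] Thm 3.3 (3.6) p.655, Thm 2.1 (2.22) p.654.
-/

noncomputable section

open scoped BigOperators Topology
open Filter MeasureTheory

namespace Summit.QuantumFields.YangMills.BalabanUVNodes.N15KingModelRung.OptimalDecay

variable {d : ℕ}

/-- On the ray `z₀ + t·e_ν`: the `ν`-th coordinate of `t·e_ν` is `t`. [folklore] -/
theorem ray_apply (z₀ : Fin (d + 1) → ℤ) (ν : Fin (d + 1)) (t : ℕ) :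
    (z₀ + (t : ℤ) • (Pi.single ν (1 : ℤ) : Fin (d + 1) → ℤ)) ν = z₀ ν + t := by
  simp

/-- Part Ϸ-c on the ray: `|S₂^{ℝ}(z₀ + t e_ν)| ≤ K_d(c,m)·e^{c|z₀,ν|}·e^{−ct}`. [cite: King1986, Thm 3.3 (3.6) p.655] -/
theorem abs_kingS2Inf_ray_le {m2 c : ℝ} (hm : 0 < m2) (hc0 : 0 < c) (hc : c ^ 2 < m2) (z₀ : Fin (d + 1) → ℤ) (ν : Fin (d + 1)) (t : ℕ) :
    |kingS2Inf m2 (z₀ + (t : ℤ) • (Pi.single ν (1 : ℤ) : Fin (d + 1) → ℤ))|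
      ≤ (((2 * Real.pi) ^ (d + 1))⁻¹ * (2 * Real.pi * (1 + Real.cosh c) / (c * (m2 - c ^ 2))) * ((17 + 16 * Real.pi ^ 2) * Real.pi) ^ d
          * Real.exp (c * |(z₀ ν : ℝ)|)) * Real.exp (-(c * t)) := by
  have h := abs_kingS2Inf_le_exp_of_sq_lt hm hc0 hc (z₀ + (t : ℤ) • (Pi.single ν (1 : ℤ) : Fin (d + 1) → ℤ)) ν
  rw [ray_apply] at h
  refine h.trans ?_
  have hK : 0 ≤ ((2 * Real.pi) ^ (d + 1))⁻¹ * (2 * Real.pi * (1 + Real.cosh c) / (c * (m2 - c ^ 2))) * ((17 + 16 * Real.pi ^ 2) * Real.pi) ^ d := by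
    have : 0 < m2 - c ^ 2 := by linarith
    positivity
  -- `−c|z₀,ν + t| ≤ c|z₀,ν| − ct`
  have h1 : (t : ℝ) - |(z₀ ν : ℝ)| ≤ |((z₀ ν + t : ℤ) : ℝ)| := by
    push_cast
    have h2 : |(t : ℝ)| = t := abs_of_nonneg (Nat.cast_nonneg t)
    have := abs_add_le ((z₀ ν : ℝ) + t) (-(z₀ ν : ℝ))
    rw [show (z₀ ν : ℝ) + t + -(z₀ ν : ℝ) = t by ring, h2, abs_neg] at this
    linarith
  calc _ ≤ ((2 * Real.pi) ^ (d + 1))⁻¹ * (2 * Real.pi * (1 + Real.cosh c) / (c * (m2 - c ^ 2))) * ((17 + 16 * Real.pi ^ 2) * Real.pi) ^ d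
          * Real.exp (c * |(z₀ ν : ℝ)| + -(c * t)) := by
        refine mul_le_mul_of_nonneg_left (Real.exp_le_exp.mpr ?_) hK
        nlinarith
    _ = _ := by rw [Real.exp_add]; ring

/-- ★ The `t`-th root form, `t ≥ 1`: `|S₂^{ℝ}(z₀ + t e_ν)|^{1∕t} ≤ K̃^{1∕t}·e^{−c}` (`K̃ = K_d(c,m)e^{c|z₀,ν|}`). [folklore] -/
theorem rpow_inv_abs_kingS2Inf_ray_le {m2 c : ℝ} (hm : 0 < m2) (hc0 : 0 < c) (hc : c ^ 2 < m2) (z₀ : Fin (d + 1) → ℤ) (ν : Fin (d + 1))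
    {t : ℕ} (ht : 1 ≤ t) :
    |kingS2Inf m2 (z₀ + (t : ℤ) • (Pi.single ν (1 : ℤ) : Fin (d + 1) → ℤ))| ^ ((t : ℝ)⁻¹)
      ≤ (((2 * Real.pi) ^ (d + 1))⁻¹ * (2 * Real.pi * (1 + Real.cosh c) / (c * (m2 - c ^ 2))) * ((17 + 16 * Real.pi ^ 2) * Real.pi) ^ d
          * Real.exp (c * |(z₀ ν : ℝ)|)) ^ ((t : ℝ)⁻¹) * Real.exp (-c) := by
  have ht0 : (0 : ℝ) < t := by exact_mod_cast ht
  have hK : 0 ≤ ((2 * Real.pi) ^ (d + 1))⁻¹ * (2 * Real.pi * (1 + Real.cosh c) / (c * (m2 - c ^ 2))) * ((17 + 16 * Real.pi ^ 2) * Real.pi) ^ d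
      * Real.exp (c * |(z₀ ν : ℝ)|) := by
    have : 0 < m2 - c ^ 2 := by linarith
    positivity
  have h := Real.rpow_le_rpow (abs_nonneg _) (abs_kingS2Inf_ray_le hm hc0 hc z₀ ν t) (inv_nonneg.mpr ht0.le)
  refine h.trans (le_of_eq ?_)
  rw [Real.mul_rpow hK (Real.exp_pos _).le, ← Real.exp_mul]
  congr 2
  field_simp

/-- `K^{1∕t} → 1` as `t → ∞` (`K > 0`; private plumbing). [folklore] -/
private theorem tendsto_const_rpow_inv {K : ℝ} (hK : 0 < K) : Tendsto (fun t : ℕ => K ^ ((t : ℝ)⁻¹)) atTop (𝓝 1) := by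
  have h : (fun t : ℕ => K ^ ((t : ℝ)⁻¹)) = fun t : ℕ => Real.exp (Real.log K / (t : ℝ)) := by
    funext t
    rw [Real.rpow_def_of_pos hK, div_eq_mul_inv]
  rw [h, ← Real.exp_zero]
  exact (Real.continuous_exp.tendsto 0).comp (tendsto_const_div_atTop_nhds_zero_nat (Real.log K))

/-- ★★ For every `0 < c < m`: `limsup_t |S₂^{ℝ}(z₀ + t e_ν)|^{1∕t} ≤ e^{−c}`. [cite: King1986, Thm 3.3 (3.6) p.655] -/
theorem limsup_rpow_abs_kingS2Inf_ray_le_exp {m2 c : ℝ} (hm : 0 < m2) (hc0 : 0 < c) (hc : c ^ 2 < m2) (z₀ : Fin (d + 1) → ℤ) (ν : Fin (d + 1)) :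
    limsup (fun t : ℕ => |kingS2Inf m2 (z₀ + (t : ℤ) • (Pi.single ν (1 : ℤ) : Fin (d + 1) → ℤ))| ^ ((t : ℝ)⁻¹)) atTop ≤ Real.exp (-c) := by
  set K : ℝ := ((2 * Real.pi) ^ (d + 1))⁻¹ * (2 * Real.pi * (1 + Real.cosh c) / (c * (m2 - c ^ 2))) * ((17 + 16 * Real.pi ^ 2) * Real.pi) ^ d
      * Real.exp (c * |(z₀ ν : ℝ)|) with hKdef
  have hK : 0 < K := by
    have : 0 < m2 - c ^ 2 := by linarith
    positivity
  have hg : Tendsto (fun t : ℕ => K ^ ((t : ℝ)⁻¹) * Real.exp (-c)) atTop (𝓝 (Real.exp (-c))) := by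
    have h := (tendsto_const_rpow_inv hK).mul_const (Real.exp (-c))
    rwa [one_mul] at h
  rw [← hg.limsup_eq]
  refine limsup_le_limsup ?_ ?_ hg.isBoundedUnder_le
  · filter_upwards [eventually_ge_atTop 1] with t ht
    exact rpow_inv_abs_kingS2Inf_ray_le hm hc0 hc z₀ ν ht
  · exact isCoboundedUnder_le_of_eventually_le _ (Eventually.of_forall fun t => Real.rpow_nonneg (abs_nonneg _) _)

/-- ★★★ **THE CORRELATION LENGTH OF THE FREE BLOCK FIELD IS AT MOST `1∕m` IN EVERY LATTICE DIRECTION**: for `m² > 0`, every base point `z₀ ∈ ℤ^{d+1}` and every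
coordinate direction `ν`, `limsup_{t→∞} |S₂^{ℝ}(z₀ + t e_ν)|^{1∕t} ≤ e^{−√m²}` — the exponential decay rate of the infinite-volume block two-point function along every
lattice ray is at least the mass. [cite: King1986, Thm 3.3 (3.6) p.655, Thm 2.1 (2.22) p.654] -/
theorem limsup_rpow_abs_kingS2Inf_ray_le {m2 : ℝ} (hm : 0 < m2) (z₀ : Fin (d + 1) → ℤ) (ν : Fin (d + 1)) :
    limsup (fun t : ℕ => |kingS2Inf m2 (z₀ + (t : ℤ) • (Pi.single ν (1 : ℤ) : Fin (d + 1) → ℤ))| ^ ((t : ℝ)⁻¹)) atTop ≤ Real.exp (-Real.sqrt m2) := by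
  have hsq : 0 < Real.sqrt m2 := Real.sqrt_pos.mpr hm
  -- `c ↦ e^{−c}` is continuous at `√m²` from the left, and the bound holds for every `c ∈ (0, √m²)`
  have hcont : Tendsto (fun c : ℝ => Real.exp (-c)) (𝓝[<] Real.sqrt m2) (𝓝 (Real.exp (-Real.sqrt m2))) :=
    ((Real.continuous_exp.comp continuous_neg).tendsto (Real.sqrt m2)).mono_left nhdsWithin_le_nhds
  refine ge_of_tendsto hcont ?_
  have hev : ∀ᶠ c in 𝓝[<] Real.sqrt m2, 0 < c := by
    have : Set.Ioo 0 (Real.sqrt m2) ∈ 𝓝[<] Real.sqrt m2 := Ioo_mem_nhdsLT hsq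
    filter_upwards [this] with c hc
    exact hc.1
  have hev2 : ∀ᶠ c in 𝓝[<] Real.sqrt m2, c < Real.sqrt m2 := self_mem_nhdsWithin
  filter_upwards [hev, hev2] with c hc0 hc1
  have hc : c ^ 2 < m2 := by
    have h := pow_lt_pow_left₀ hc1 hc0.le two_ne_zero
    rwa [Real.sq_sqrt hm.le] at h
  exact limsup_rpow_abs_kingS2Inf_ray_le_exp hm hc0 hc z₀ ν

end Summit.QuantumFields.YangMills.BalabanUVNodes.N15KingModelRung.OptimalDecay
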